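import Summits.CriticalPhenomena.PercolationContinuityZ3.Theorems.PercNearOneGluingNoHeavyLowerTailSahiCombMixMixedFourPieces

/-!
# The comb (tensor-Bernstein) hierarchy for Sahi's `E_k`, LV: the five GENERIC mixed three-slot cells of four events at the comb level

Support file of the one-cut programme (crux `NoHeavyLowerTail`, stmt-CriticalPhenomena-4575; cell `prim-masterthm`, seat P3, gen 10;
`run/shared/lean/prim/prim-masterthm/prim-masterthm-p3/HIERARCHY.md` §17(l), §18).  The last open interface of the mixed one-coordinate step over four events
(`SahiCombMix.CombCanonThreeSlotMixedCells`, `…SahiCombMixMixedFour`) consists of cubic rows `E_3(μ_p; S_0, S_1, S_2)` whose slots `S_j` are intersections of the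
mixed members `orAndCoord U e G₁ G₂ i`; every such slot is a `mixCoord e P Q` with `P ∈ {∅, U_K}` and `Q = U_{K'}` (`…SahiCombMixMixedFour`,
`biInter_orAndCoord_eq_mixCoord`).  Up to relabelling, duplicating and intersecting members (`CombHereditary.of_eq_biInter`) and permuting slots, the cells with an
AND-type slot (`P = ∅`) and a genuinely generic slot (`∅ ≠ P ⊊ Q`) are the FIVE MASTER CELLS of this file; for four events `V_0..V_3` of a finite cube ignoring `e`
with `CombHereditary V` (write `H = {e ∈ ω}`, `m_S = μ_p(V_S)`, `d(X;Y) = m_X − m_{X∪Y}`):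
* `combPos_three_APG` — `(H∩V_0, V_1, V_2∩(V_3∪H))`:  `p_e·E_3(V_0,V_1,V_2) + p_e(1−p_e)·[Cov(V_0,V_1)d(2;3) + m_0·d(12;3)]`;
* `combPos_three_AOG` — `(H∩V_0, V_1∪H, V_2∩(V_3∪H))`: `T = Cov(V_0,V_2)`, `W₂ = T(1−m_1) + m_0[d(23;1) + m_1 d(2;3)]`, `W₃ = m_0 d(2;3)(1−m_1)`;
* `combPos_three_AAG` — `(H∩V_0, H∩V_1, V_2∩(V_3∪H))`: `T = E_3(V_0,V_1,V_2)`, `W₂ = Cov(0,1)d(2;3) + Cov(0,2)m_1 + Cov(1,2)m_0 + m_0m_1m_{23}`, `W₃ = m_0m_1d(2;3)`;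
* `combPos_three_AGG` — `(H∩V_0, V_1∩(V_2∪H), V_3∩(V_2∪H))` (two generic slots with the same OR-part);
* `combPos_three_AGG'` — `(H∩V_0, V_1∩(V_2∪H), V_1∩(V_3∪H))` (two generic slots with the same AND-part);
each `= p_e·T + p_e(1−p_e)·W₂ + p_e(1−p_e)(2−p_e)·W₃`, i.e. unnormalised Bernstein coefficients `(0, T+W₂+2W₃, 2T+W₂+W₃, T)` along `p_e`, every coefficient a sum of
products of hereditary comb rows of `V` and nonnegative Venn moments off `e` (exact polynomial identities, checked symbolically by the seat script
`py/cells3slot.py`; in Lean: `sahiE_three_mixCoord_eq` + `ring`).  Building blocks indexed by finsets (`cK_mem`, `cK_const_sub`, `cK_diff`, `cK_row2`, `cK_row3`).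
The dispatcher over all selector pairs (⇒ `CombCanonThreeSlotMixedCells k`, ⇒ decision-list quadruples) is the sequel.
HONEST FRAMING: nothing here asserts (M⁺-k) or `C_k` for `k ≥ 3`. [this work]
-/

noncomputable section

open scoped Classical

namespace Summit.CriticalPhenomena.PercolationContinuityZ3.Theorems

open Finset Function
open Literature.Combinatorics.Sahi2008
open Literature.Probability.Percolation.BHK2006 (ind_le_one ind_inter)
open Literature.Probability.Percolation.DecisionTree (ind ind_of_mem ind_of_not_mem ind_nonneg)
open SahiComb
open SahiCombHereditary (CombHereditary)

variable {ι : Type} [Fintype ι]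

namespace SahiCombMix

/-! ### Finset-indexed building blocks: moments, differences and rows of the ∩-closed family off `e` -/

section Blocks

variable (U : Fin 4 → Set (Set ι)) (e : ι) (hUe : ∀ (j : Fin 4) (b : Bool), secAt e b (U j) = U j)
include hUe

omit [Fintype ι] in
/-- Indicators of members of the ∩-closed family ignore `e`. [folklore] -/
theorem ind_biInter_insert (S : Finset (Fin 4)) (ω : Set ι) : ind (⋂ i ∈ S, U i) (insert e ω) = ind (⋂ i ∈ S, U i) ω := by
  rw [← secAt_biInter U e hUe S true]; exact ind_secAt_insert e true _ ω

/-- `m_S = μ_p(U_S)`, comb degree `1` off `e`. [this work] -/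
theorem cK_mem (S : Finset (Fin 4)) : CombPos (update (fun _ : ι => 1) e 0) (fun p => ex (bernoulliWeight p) (ind (⋂ i ∈ S, U i))) :=
  combPos_lin_off e (ind (⋂ i ∈ S, U i)) (ind_nonneg _) (ind_biInter_insert U e hUe S) _ fun _ => rfl

/-- `a − m_S` for `a ≥ 1`, comb degree `1` off `e`. [this work] -/
theorem cK_const_sub (S : Finset (Fin 4)) {a : ℝ} (ha : 1 ≤ a) :
    CombPos (update (fun _ : ι => 1) e 0) (fun p => a - ex (bernoulliWeight p) (ind (⋂ i ∈ S, U i))) := by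
  refine combPos_lin_off e (fun ω => a - ind (⋂ i ∈ S, U i) ω) (fun ω => sub_nonneg.2 ((ind_le_one _ ω).trans ha))
    (fun ω => by rw [ind_biInter_insert U e hUe]) _ fun p => ?_
  have ee := SahiMixture.ex_eq_lin (bernoulliWeight p) (fun ω => a - ind (⋂ i ∈ S, U i) ω) ![a, -1] ![fun _ => 1, ind (⋂ i ∈ S, U i)]
    (fun ω => by simp [Fin.sum_univ_succ]; ring)
  simp only [Fin.sum_univ_succ, Fin.sum_univ_zero, Matrix.cons_val_zero, Matrix.cons_val_succ, ex_const (sum_bernoulliWeight p)] at ee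
  rw [ee]; ring

/-- `d(S;T) = m_S − m_T ≥ 0` for `S ⊆ T` (so `U_T ⊆ U_S`), comb degree `1` off `e`. [this work] -/
theorem cK_diff (S T : Finset (Fin 4)) (hST : S ⊆ T) :
    CombPos (update (fun _ : ι => 1) e 0) (fun p => ex (bernoulliWeight p) (ind (⋂ i ∈ S, U i)) - ex (bernoulliWeight p) (ind (⋂ i ∈ T, U i))) := by
  have hTS : (⋂ i ∈ T, U i) ⊆ ⋂ i ∈ S, U i := Set.biInter_subset_biInter_left (Finset.coe_subset.2 hST)
  refine combPos_lin_off e (fun ω => ind (⋂ i ∈ S, U i) ω - ind (⋂ i ∈ T, U i) ω) (fun ω => ?_)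
    (fun ω => by rw [ind_biInter_insert U e hUe, ind_biInter_insert U e hUe]) _ fun p => ?_
  · by_cases hT : ω ∈ ⋂ i ∈ T, U i
    · rw [ind_of_mem hT, ind_of_mem (hTS hT)]; norm_num
    · rw [ind_of_not_mem hT, sub_zero]; exact ind_nonneg _ ω
  · have ee := SahiMixture.ex_eq_lin (bernoulliWeight p) (fun ω => ind (⋂ i ∈ S, U i) ω - ind (⋂ i ∈ T, U i) ω) ![1, -1]
      ![ind (⋂ i ∈ S, U i), ind (⋂ i ∈ T, U i)] (fun ω => by simp [Fin.sum_univ_succ]; ring)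
    simp only [Fin.sum_univ_succ, Fin.sum_univ_zero, Matrix.cons_val_zero, Matrix.cons_val_succ] at ee
    rw [ee]; ring

/-- The hereditary covariance row `m_{S∪T} − m_S m_T` (with `S ∪ T` given as a literal `R`), comb degree `2` off `e`. [this work] -/
theorem cK_row2 (hU : CombHereditary U) (S T R : Finset (Fin 4)) (hR : S ∪ T = R) :
    CombPos (update (fun _ : ι => 2) e 0) (fun p => ex (bernoulliWeight p) (ind (⋂ i ∈ R, U i))
      - ex (bernoulliWeight p) (ind (⋂ i ∈ S, U i)) * ex (bernoulliWeight p) (ind (⋂ i ∈ T, U i))) := by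
  have r := hU.row_off e hUe 2 ![S, T]
  rw [SahiMixture.fam2] at r
  refine r.congr fun p => ?_
  rw [sahiE_two_apply]
  simp only [Matrix.cons_val_zero, Matrix.cons_val_one, SahiMixture.ind_biInter_mul, hR]

/-- The hereditary cubic row `E_3(U_S, U_T, U_R) = 2m_{STR} + m_S m_T m_R − (m_S m_{TR} + m_T m_{SR} + m_R m_{ST})` (unions given as literals), comb degree `3`
off `e`. [this work] -/
theorem cK_row3 (hU : CombHereditary U) (S T R ST SR TR STR : Finset (Fin 4)) (hST : S ∪ T = ST) (hSR : S ∪ R = SR) (hTR : T ∪ R = TR)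
    (hSTR : ST ∪ R = STR) :
    CombPos (update (fun _ : ι => 3) e 0) (fun p => 2 * ex (bernoulliWeight p) (ind (⋂ i ∈ STR, U i))
      + ex (bernoulliWeight p) (ind (⋂ i ∈ S, U i)) * ex (bernoulliWeight p) (ind (⋂ i ∈ T, U i)) * ex (bernoulliWeight p) (ind (⋂ i ∈ R, U i))
      - (ex (bernoulliWeight p) (ind (⋂ i ∈ S, U i)) * ex (bernoulliWeight p) (ind (⋂ i ∈ TR, U i))
        + ex (bernoulliWeight p) (ind (⋂ i ∈ T, U i)) * ex (bernoulliWeight p) (ind (⋂ i ∈ SR, U i))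
        + ex (bernoulliWeight p) (ind (⋂ i ∈ R, U i)) * ex (bernoulliWeight p) (ind (⋂ i ∈ ST, U i)))) := by
  have r := hU.row_off e hUe 3 ![S, T, R]
  rw [SahiMixture.fam3] at r
  refine r.congr fun p => ?_
  rw [sahiE_three_apply]
  simp only [Matrix.cons_val_zero, Matrix.cons_val_one, Matrix.cons_val_two, Matrix.head_cons, Matrix.tail_cons, SahiMixture.ind_biInter_mul,
    hST, hSR, hTR, hSTR]

omit hUe in
/-- The empty intersection has mass `1`. [folklore] -/
theorem ex_ind_biInter_empty (p : ι → unitInterval) : ex (bernoulliWeight p) (ind (⋂ i ∈ (∅ : Finset (Fin 4)), U i)) = 1 := by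
  rw [SahiMixture.biInter_finset_empty]; exact SahiCombDisjunct.ex_ind_univ p

end Blocks

/-! ### The five master cells -/

section Cells

variable (U : Fin 4 → Set (Set ι)) (e : ι) (hUe : ∀ (j : Fin 4) (b : Bool), secAt e b (U j) = U j) (hU : CombHereditary U)
include hUe hU

/-- **Master cell APG** `(H∩U_0, U_1, U_2∩(U_3∪H))`, slots as `mixCoord e P Q` with `P = (∅, U_1, U_{23})`, `Q = (U_0, U_1, U_2)`:
the cubic row is comb-positive at multidegree `3` (`= p_e·E_3(U_0,U_1,U_2) + p_e(1−p_e)·[Cov(U_0,U_1)(m_2−m_{23}) + m_0(m_{12}−m_{123})]`). [this work] -/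
theorem combPos_three_APG :
    CombPos (fun _ : ι => 3) (fun p => sahiE (bernoulliWeight p) 3 (fun j => ind (mixCoord e
      ((![∅, ⋂ i ∈ ({1} : Finset (Fin 4)), U i, ⋂ i ∈ ({2, 3} : Finset (Fin 4)), U i] : Fin 3 → Set (Set ι)) j)
      ((![⋂ i ∈ ({0} : Finset (Fin 4)), U i, ⋂ i ∈ ({1} : Finset (Fin 4)), U i, ⋂ i ∈ ({2} : Finset (Fin 4)), U i] : Fin 3 → Set (Set ι)) j)))) := by
  have hz : ind (∅ : Set (Set ι)) = 0 := funext fun ω => ind_of_not_mem (Set.notMem_empty ω)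
  have u01 : (({0} : Finset (Fin 4)) ∪ ({1} : Finset (Fin 4))) = ({0, 1} : Finset (Fin 4)) := by decide
  have u02 : (({0} : Finset (Fin 4)) ∪ ({2} : Finset (Fin 4))) = ({0, 2} : Finset (Fin 4)) := by decide
  have u12 : (({1} : Finset (Fin 4)) ∪ ({2} : Finset (Fin 4))) = ({1, 2} : Finset (Fin 4)) := by decide
  have u012 : (({0, 1} : Finset (Fin 4)) ∪ ({2} : Finset (Fin 4))) = ({0, 1, 2} : Finset (Fin 4)) := by decide
  have u123 : (({1} : Finset (Fin 4)) ∪ ({2, 3} : Finset (Fin 4))) = ({1, 2, 3} : Finset (Fin 4)) := by decide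
  have T := cK_row3 U e hUe hU {0} {1} {2} {0, 1} {0, 2} {1, 2} {0, 1, 2} u01 u02 u12 u012
  have W2 := ((cK_row2 U e hUe hU {0} {1} {0, 1} u01).mul_off e (cK_diff U e hUe {2} {2, 3} (by decide)) (show 2 + 1 ≤ 3 by norm_num)).add
    ((cK_mem U e hUe {0}).mul_off e (cK_diff U e hUe {1, 2} {1, 2, 3} (by decide)) (show 1 + 1 ≤ 3 by norm_num))
  refine combPos_three_mixCoord_of_coeffs e _ _ ?_ ?_ ?_ ?_ ?_ ?_ ?_
  · intro j b; fin_cases j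
    · exact secAt_empty' e b
    · exact secAt_biInter U e hUe _ b
    · exact secAt_biInter U e hUe _ b
  · intro j b; fin_cases j <;> exact secAt_biInter U e hUe _ b
  · intro j; fin_cases j
    · exact Set.empty_subset _
    · exact le_rfl
    · exact Set.biInter_subset_biInter_left (Finset.coe_subset.2 (by decide))
  · refine (CombPos.zero _).congr fun p => ?_
    rw [sahiE_three_apply]
    simp [hz, SahiMixture.ex_zero_fun]
  · refine (T.add W2).congr fun p => ?_
    simp only [mixC1, Matrix.cons_val_zero, Matrix.cons_val_one, Matrix.cons_val_two, Matrix.head_cons, Matrix.tail_cons, hz, zero_mul, mul_zero,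
      SahiMixture.ex_zero_fun, SahiMixture.ind_biInter_mul, u01, u02, u12, u012, u123]
    ring
  · refine ((T.smul (by norm_num : (0:ℝ) ≤ 2)).add W2).congr fun p => ?_
    simp only [mixC2, Matrix.cons_val_zero, Matrix.cons_val_one, Matrix.cons_val_two, Matrix.head_cons, Matrix.tail_cons, hz, zero_mul, mul_zero,
      SahiMixture.ex_zero_fun, SahiMixture.ind_biInter_mul, u01, u02, u12, u012, u123]
    ring
  · exact (hU.row_off e hUe 3 ![({0} : Finset (Fin 4)), ({1} : Finset (Fin 4)), ({2} : Finset (Fin 4))]).congr fun p => by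
      congr 1; funext j; fin_cases j <;> rfl

/-- **Master cell AOG** `(H∩U_0, U_1∪H, U_2∩(U_3∪H))`, slots `P = (∅, U_1, U_{23})`, `Q = (U_0, Ω, U_2)` (`Ω` as the empty intersection):
`T = Cov(U_0,U_2)`, `W₂ = T(1−m_1) + m_0[(m_{23}−m_{123}) + m_1(m_2−m_{23})]`, `W₃ = m_0(m_2−m_{23})(1−m_1)`. [this work] -/
theorem combPos_three_AOG :
    CombPos (fun _ : ι => 3) (fun p => sahiE (bernoulliWeight p) 3 (fun j => ind (mixCoord e
      ((![∅, ⋂ i ∈ ({1} : Finset (Fin 4)), U i, ⋂ i ∈ ({2, 3} : Finset (Fin 4)), U i] : Fin 3 → Set (Set ι)) j)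
      ((![⋂ i ∈ ({0} : Finset (Fin 4)), U i, ⋂ i ∈ (∅ : Finset (Fin 4)), U i, ⋂ i ∈ ({2} : Finset (Fin 4)), U i] : Fin 3 → Set (Set ι)) j)))) := by
  have hz : ind (∅ : Set (Set ι)) = 0 := funext fun ω => ind_of_not_mem (Set.notMem_empty ω)
  have u0e : (({0} : Finset (Fin 4)) ∪ (∅ : Finset (Fin 4))) = ({0} : Finset (Fin 4)) := by decide
  have u02 : (({0} : Finset (Fin 4)) ∪ ({2} : Finset (Fin 4))) = ({0, 2} : Finset (Fin 4)) := by decide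
  have ue2 : ((∅ : Finset (Fin 4)) ∪ ({2} : Finset (Fin 4))) = ({2} : Finset (Fin 4)) := by decide
  have u123 : (({1} : Finset (Fin 4)) ∪ ({2, 3} : Finset (Fin 4))) = ({1, 2, 3} : Finset (Fin 4)) := by decide
  have hE := ex_ind_biInter_empty U
  have T := cK_row2 U e hUe hU {0} {2} {0, 2} u02
  have m0 := cK_mem U e hUe {0}
  have m1 := cK_mem U e hUe {1}
  have c1 := cK_const_sub U e hUe {1} (le_refl (1:ℝ))
  have d23 := cK_diff U e hUe {2} {2, 3} (by decide)
  have d231 := cK_diff U e hUe {2, 3} {1, 2, 3} (by decide)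
  have W2 := (T.mul_off e c1 (show 2 + 1 ≤ 3 by norm_num)).add
    (((m0.mul_off e d231 (show 1 + 1 ≤ 2 by norm_num)).mono (deg_off_mono e (show 2 ≤ 3 by norm_num))).add
      ((m0.mul_off e m1 (show 1 + 1 ≤ 2 by norm_num)).mul_off e d23 (show 2 + 1 ≤ 3 by norm_num)))
  have W3 := (m0.mul_off e d23 (show 1 + 1 ≤ 2 by norm_num)).mul_off e c1 (show 2 + 1 ≤ 3 by norm_num)
  refine combPos_three_mixCoord_of_coeffs e _ _ ?_ ?_ ?_ ?_ ?_ ?_ ?_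
  · intro j b; fin_cases j
    · exact secAt_empty' e b
    · exact secAt_biInter U e hUe _ b
    · exact secAt_biInter U e hUe _ b
  · intro j b; fin_cases j <;> exact secAt_biInter U e hUe _ b
  · intro j; fin_cases j
    · exact Set.empty_subset _
    · exact Set.biInter_subset_biInter_left (Finset.coe_subset.2 (by decide))
    · exact Set.biInter_subset_biInter_left (Finset.coe_subset.2 (by decide))
  · refine (CombPos.zero _).congr fun p => ?_
    rw [sahiE_three_apply]
    simp [hz, SahiMixture.ex_zero_fun]
  · refine ((T.mono (deg_off_mono e (show 2 ≤ 3 by norm_num))).add (W2.add (W3.smul (by norm_num : (0:ℝ) ≤ 2)))).congr fun p => ?_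
    simp only [mixC1, Matrix.cons_val_zero, Matrix.cons_val_one, Matrix.cons_val_two, Matrix.head_cons, Matrix.tail_cons, hz, zero_mul, mul_zero,
      SahiMixture.ex_zero_fun, SahiMixture.ind_biInter_mul, u0e, u02, ue2, u123, hE]
    ring
  · refine ((((T.mono (deg_off_mono e (show 2 ≤ 3 by norm_num))).smul (by norm_num : (0:ℝ) ≤ 2)).add W2).add W3).congr fun p => ?_
    simp only [mixC2, Matrix.cons_val_zero, Matrix.cons_val_one, Matrix.cons_val_two, Matrix.head_cons, Matrix.tail_cons, hz, zero_mul, mul_zero,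
      SahiMixture.ex_zero_fun, SahiMixture.ind_biInter_mul, u0e, u02, ue2, u123, hE]
    ring
  · refine ((T.mono (deg_off_mono e (show 2 ≤ 3 by norm_num)))).congr fun p => ?_
    rw [sahiE_three_apply]
    simp only [Matrix.cons_val_zero, Matrix.cons_val_one, Matrix.cons_val_two, Matrix.head_cons, Matrix.tail_cons, SahiMixture.ind_biInter_mul,
      u0e, u02, ue2, hE]
    ring

/-- **Master cell AAG** `(H∩U_0, H∩U_1, U_2∩(U_3∪H))`, slots `P = (∅, ∅, U_{23})`, `Q = (U_0, U_1, U_2)`: `T = E_3(U_0,U_1,U_2)`,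
`W₂ = Cov(0,1)(m_2−m_{23}) + Cov(0,2)m_1 + Cov(1,2)m_0 + m_0m_1m_{23}`, `W₃ = m_0m_1(m_2−m_{23})`. [this work] -/
theorem combPos_three_AAG :
    CombPos (fun _ : ι => 3) (fun p => sahiE (bernoulliWeight p) 3 (fun j => ind (mixCoord e
      ((![∅, ∅, ⋂ i ∈ ({2, 3} : Finset (Fin 4)), U i] : Fin 3 → Set (Set ι)) j)
      ((![⋂ i ∈ ({0} : Finset (Fin 4)), U i, ⋂ i ∈ ({1} : Finset (Fin 4)), U i, ⋂ i ∈ ({2} : Finset (Fin 4)), U i] : Fin 3 → Set (Set ι)) j)))) := by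
  have hz : ind (∅ : Set (Set ι)) = 0 := funext fun ω => ind_of_not_mem (Set.notMem_empty ω)
  have u01 : (({0} : Finset (Fin 4)) ∪ ({1} : Finset (Fin 4))) = ({0, 1} : Finset (Fin 4)) := by decide
  have u02 : (({0} : Finset (Fin 4)) ∪ ({2} : Finset (Fin 4))) = ({0, 2} : Finset (Fin 4)) := by decide
  have u12 : (({1} : Finset (Fin 4)) ∪ ({2} : Finset (Fin 4))) = ({1, 2} : Finset (Fin 4)) := by decide
  have u012 : (({0, 1} : Finset (Fin 4)) ∪ ({2} : Finset (Fin 4))) = ({0, 1, 2} : Finset (Fin 4)) := by decide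
  have T := cK_row3 U e hUe hU {0} {1} {2} {0, 1} {0, 2} {1, 2} {0, 1, 2} u01 u02 u12 u012
  have m0 := cK_mem U e hUe {0}
  have m1 := cK_mem U e hUe {1}
  have d23 := cK_diff U e hUe {2} {2, 3} (by decide)
  have W2 := ((((cK_row2 U e hUe hU {0} {1} {0, 1} u01).mul_off e d23 (show 2 + 1 ≤ 3 by norm_num)).add
    ((cK_row2 U e hUe hU {0} {2} {0, 2} u02).mul_off e m1 (show 2 + 1 ≤ 3 by norm_num))).add
    ((cK_row2 U e hUe hU {1} {2} {1, 2} u12).mul_off e m0 (show 2 + 1 ≤ 3 by norm_num))).add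
    ((m0.mul_off e m1 (show 1 + 1 ≤ 2 by norm_num)).mul_off e (cK_mem U e hUe {2, 3}) (show 2 + 1 ≤ 3 by norm_num))
  have W3 := (m0.mul_off e m1 (show 1 + 1 ≤ 2 by norm_num)).mul_off e d23 (show 2 + 1 ≤ 3 by norm_num)
  refine combPos_three_mixCoord_of_coeffs e _ _ ?_ ?_ ?_ ?_ ?_ ?_ ?_
  · intro j b; fin_cases j
    · exact secAt_empty' e b
    · exact secAt_empty' e b
    · exact secAt_biInter U e hUe _ b
  · intro j b; fin_cases j <;> exact secAt_biInter U e hUe _ b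
  · intro j; fin_cases j
    · exact Set.empty_subset _
    · exact Set.empty_subset _
    · exact Set.biInter_subset_biInter_left (Finset.coe_subset.2 (by decide))
  · refine (CombPos.zero _).congr fun p => ?_
    rw [sahiE_three_apply]
    simp [hz, SahiMixture.ex_zero_fun]
  · refine (T.add (W2.add (W3.smul (by norm_num : (0:ℝ) ≤ 2)))).congr fun p => ?_
    simp only [mixC1, Matrix.cons_val_zero, Matrix.cons_val_one, Matrix.cons_val_two, Matrix.head_cons, Matrix.tail_cons, hz, zero_mul, mul_zero,
      SahiMixture.ex_zero_fun, SahiMixture.ind_biInter_mul, u01, u02, u12, u012]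
    ring
  · refine ((((T.smul (by norm_num : (0:ℝ) ≤ 2))).add W2).add W3).congr fun p => ?_
    simp only [mixC2, Matrix.cons_val_zero, Matrix.cons_val_one, Matrix.cons_val_two, Matrix.head_cons, Matrix.tail_cons, hz, zero_mul, mul_zero,
      SahiMixture.ex_zero_fun, SahiMixture.ind_biInter_mul, u01, u02, u12, u012]
    ring
  · exact (hU.row_off e hUe 3 ![({0} : Finset (Fin 4)), ({1} : Finset (Fin 4)), ({2} : Finset (Fin 4))]).congr fun p => by
      congr 1; funext j; fin_cases j <;> rfl

/-- **Master cell AGG** `(H∩U_0, U_1∩(U_2∪H), U_3∩(U_2∪H))` (two generic slots sharing the OR-part `U_2`), slots `P = (∅, U_{12}, U_{23})`, `Q = (U_0, U_1, U_3)`: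
`T = E_3(U_0,U_1,U_3)`, `c_1 = T + Cov(0,1)(m_3−m_{23}) + Cov(0,3)(m_1−m_{12}) + m_0[(m_{13}−m_{123}) + (m_1−m_{12})(m_3−m_{23})]`,
`c_2 = 2T + Cov(0,1)(m_3−m_{23}) + Cov(0,3)(m_1−m_{12}) + m_0(m_{13}−m_{123})`, `c_3 = T`. [this work] -/
theorem combPos_three_AGG :
    CombPos (fun _ : ι => 3) (fun p => sahiE (bernoulliWeight p) 3 (fun j => ind (mixCoord e
      ((![∅, ⋂ i ∈ ({1, 2} : Finset (Fin 4)), U i, ⋂ i ∈ ({2, 3} : Finset (Fin 4)), U i] : Fin 3 → Set (Set ι)) j)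
      ((![⋂ i ∈ ({0} : Finset (Fin 4)), U i, ⋂ i ∈ ({1} : Finset (Fin 4)), U i, ⋂ i ∈ ({3} : Finset (Fin 4)), U i] : Fin 3 → Set (Set ι)) j)))) := by
  have hz : ind (∅ : Set (Set ι)) = 0 := funext fun ω => ind_of_not_mem (Set.notMem_empty ω)
  have u01 : (({0} : Finset (Fin 4)) ∪ ({1} : Finset (Fin 4))) = ({0, 1} : Finset (Fin 4)) := by decide
  have u03 : (({0} : Finset (Fin 4)) ∪ ({3} : Finset (Fin 4))) = ({0, 3} : Finset (Fin 4)) := by decide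
  have u13 : (({1} : Finset (Fin 4)) ∪ ({3} : Finset (Fin 4))) = ({1, 3} : Finset (Fin 4)) := by decide
  have u013 : (({0, 1} : Finset (Fin 4)) ∪ ({3} : Finset (Fin 4))) = ({0, 1, 3} : Finset (Fin 4)) := by decide
  have u1223 : (({1, 2} : Finset (Fin 4)) ∪ ({2, 3} : Finset (Fin 4))) = ({1, 2, 3} : Finset (Fin 4)) := by decide
  have T := cK_row3 U e hUe hU {0} {1} {3} {0, 1} {0, 3} {1, 3} {0, 1, 3} u01 u03 u13 u013
  have m0 := cK_mem U e hUe {0}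
  have d32 := cK_diff U e hUe {3} {2, 3} (by decide)
  have d12 := cK_diff U e hUe {1} {1, 2} (by decide)
  have d132 := cK_diff U e hUe {1, 3} {1, 2, 3} (by decide)
  have X := ((cK_row2 U e hUe hU {0} {1} {0, 1} u01).mul_off e d32 (show 2 + 1 ≤ 3 by norm_num)).add
    ((cK_row2 U e hUe hU {0} {3} {0, 3} u03).mul_off e d12 (show 2 + 1 ≤ 3 by norm_num))
  have Y := (m0.mul_off e d132 (show 1 + 1 ≤ 2 by norm_num)).mono (deg_off_mono e (show 2 ≤ 3 by norm_num))
  have Z := (m0.mul_off e d12 (show 1 + 1 ≤ 2 by norm_num)).mul_off e d32 (show 2 + 1 ≤ 3 by norm_num)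
  refine combPos_three_mixCoord_of_coeffs e _ _ ?_ ?_ ?_ ?_ ?_ ?_ ?_
  · intro j b; fin_cases j
    · exact secAt_empty' e b
    · exact secAt_biInter U e hUe _ b
    · exact secAt_biInter U e hUe _ b
  · intro j b; fin_cases j <;> exact secAt_biInter U e hUe _ b
  · intro j; fin_cases j
    · exact Set.empty_subset _
    · exact Set.biInter_subset_biInter_left (Finset.coe_subset.2 (by decide))
    · exact Set.biInter_subset_biInter_left (Finset.coe_subset.2 (by decide))
  · refine (CombPos.zero _).congr fun p => ?_
    rw [sahiE_three_apply]
    simp [hz, SahiMixture.ex_zero_fun]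
  · refine (T.add (X.add (Y.add Z))).congr fun p => ?_
    simp only [mixC1, Matrix.cons_val_zero, Matrix.cons_val_one, Matrix.cons_val_two, Matrix.head_cons, Matrix.tail_cons, hz, zero_mul, mul_zero,
      SahiMixture.ex_zero_fun, SahiMixture.ind_biInter_mul, u01, u03, u13, u013, u1223]
    ring
  · refine (((T.smul (by norm_num : (0:ℝ) ≤ 2)).add X).add Y).congr fun p => ?_
    simp only [mixC2, Matrix.cons_val_zero, Matrix.cons_val_one, Matrix.cons_val_two, Matrix.head_cons, Matrix.tail_cons, hz, zero_mul, mul_zero,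
      SahiMixture.ex_zero_fun, SahiMixture.ind_biInter_mul, u01, u03, u13, u013, u1223]
    ring
  · exact (hU.row_off e hUe 3 ![({0} : Finset (Fin 4)), ({1} : Finset (Fin 4)), ({3} : Finset (Fin 4))]).congr fun p => by
      congr 1; funext j; fin_cases j <;> rfl

/-- **Master cell AGG'** `(H∩U_0, U_1∩(U_2∪H), U_1∩(U_3∪H))` (two generic slots sharing the AND-part `U_1`), slots `P = (∅, U_{12}, U_{13})`,
`Q = (U_0, U_1, U_1)`: `T = E_3(U_0,U_1,U_1)`, `c_1 = T + Cov(0,1)[(m_1−m_{12}) + (m_1−m_{13})] + m_0[(m_1−m_{123}) + (m_1−m_{12})(m_1−m_{13})]`,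
`c_2 = 2T + Cov(0,1)[(m_1−m_{12}) + (m_1−m_{13})] + m_0(m_1−m_{123})`, `c_3 = T`. [this work] -/
theorem combPos_three_AGG' :
    CombPos (fun _ : ι => 3) (fun p => sahiE (bernoulliWeight p) 3 (fun j => ind (mixCoord e
      ((![∅, ⋂ i ∈ ({1, 2} : Finset (Fin 4)), U i, ⋂ i ∈ ({1, 3} : Finset (Fin 4)), U i] : Fin 3 → Set (Set ι)) j)
      ((![⋂ i ∈ ({0} : Finset (Fin 4)), U i, ⋂ i ∈ ({1} : Finset (Fin 4)), U i, ⋂ i ∈ ({1} : Finset (Fin 4)), U i] : Fin 3 → Set (Set ι)) j)))) := by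
  have hz : ind (∅ : Set (Set ι)) = 0 := funext fun ω => ind_of_not_mem (Set.notMem_empty ω)
  have u01 : (({0} : Finset (Fin 4)) ∪ ({1} : Finset (Fin 4))) = ({0, 1} : Finset (Fin 4)) := by decide
  have u11 : (({1} : Finset (Fin 4)) ∪ ({1} : Finset (Fin 4))) = ({1} : Finset (Fin 4)) := by decide
  have u011 : (({0, 1} : Finset (Fin 4)) ∪ ({1} : Finset (Fin 4))) = ({0, 1} : Finset (Fin 4)) := by decide
  have u1213 : (({1, 2} : Finset (Fin 4)) ∪ ({1, 3} : Finset (Fin 4))) = ({1, 2, 3} : Finset (Fin 4)) := by decide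
  have T := cK_row3 U e hUe hU {0} {1} {1} {0, 1} {0, 1} {1} {0, 1} u01 u01 u11 u011
  have m0 := cK_mem U e hUe {0}
  have d12 := cK_diff U e hUe {1} {1, 2} (by decide)
  have d13 := cK_diff U e hUe {1} {1, 3} (by decide)
  have d123 := cK_diff U e hUe {1} {1, 2, 3} (by decide)
  have X := (cK_row2 U e hUe hU {0} {1} {0, 1} u01).mul_off e (d12.add d13) (show 2 + 1 ≤ 3 by norm_num)
  have Y := (m0.mul_off e d123 (show 1 + 1 ≤ 2 by norm_num)).mono (deg_off_mono e (show 2 ≤ 3 by norm_num))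
  have Z := (m0.mul_off e d12 (show 1 + 1 ≤ 2 by norm_num)).mul_off e d13 (show 2 + 1 ≤ 3 by norm_num)
  refine combPos_three_mixCoord_of_coeffs e _ _ ?_ ?_ ?_ ?_ ?_ ?_ ?_
  · intro j b; fin_cases j
    · exact secAt_empty' e b
    · exact secAt_biInter U e hUe _ b
    · exact secAt_biInter U e hUe _ b
  · intro j b; fin_cases j <;> exact secAt_biInter U e hUe _ b
  · intro j; fin_cases j
    · exact Set.empty_subset _
    · exact Set.biInter_subset_biInter_left (Finset.coe_subset.2 (by decide))
    · exact Set.biInter_subset_biInter_left (Finset.coe_subset.2 (by decide))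
  · refine (CombPos.zero _).congr fun p => ?_
    rw [sahiE_three_apply]
    simp [hz, SahiMixture.ex_zero_fun]
  · refine (T.add (X.add (Y.add Z))).congr fun p => ?_
    simp only [mixC1, Matrix.cons_val_zero, Matrix.cons_val_one, Matrix.cons_val_two, Matrix.head_cons, Matrix.tail_cons, hz, zero_mul, mul_zero,
      SahiMixture.ex_zero_fun, SahiMixture.ind_biInter_mul, u01, u11, u011, u1213]
    ring
  · refine (((T.smul (by norm_num : (0:ℝ) ≤ 2)).add X).add Y).congr fun p => ?_
    simp only [mixC2, Matrix.cons_val_zero, Matrix.cons_val_one, Matrix.cons_val_two, Matrix.head_cons, Matrix.tail_cons, hz, zero_mul, mul_zero,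
      SahiMixture.ex_zero_fun, SahiMixture.ind_biInter_mul, u01, u11, u011, u1213]
    ring
  · exact (hU.row_off e hUe 3 ![({0} : Finset (Fin 4)), ({1} : Finset (Fin 4)), ({1} : Finset (Fin 4))]).congr fun p => by
      congr 1; funext j; fin_cases j <;> rfl

end Cells

end SahiCombMix

end Summit.CriticalPhenomena.PercolationContinuityZ3.Theorems

end
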